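import Literature.AnabelianGeometry.EtaleTheta.FrobenioidCyclotomicRigidity
import Literature.AnabelianGeometry.EtaleTheta.Discharge.Sec5UnitsTransport

/-!
# [EtTh] §5, Theorem 5.6 discharged modulo its cited inputs (pp. 328–329 / PDF pp. 102–103)

Mochizuki, *The étale theta function …*, Publ. RIMS **45** (2009)
[cite: MochizukiEtTh2009, Thm 5.6 p.328 (PDF p.102)].  Seat abc-iut-L2-d4 (wave-3 discharge of node `EtTh:Thm5.6(i)`,
LONG-CHAINS LC-L2-1 §5 side); PROOF-ONLY, over abc-iut-L2-t4's `FrobenioidCyclotomicRigidity.lean`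
(`CyclotomicRigidityPreserved`, `PreservesThetaSaturated`, `PreservesRigidityIso`, `PreservesCyclotomes`,
`RigidityFamily`, `IsFunctorialLinear`, `LinearlyReachableFromBN`, the PROVED uniqueness
`rigidityFamily_unique_of`) and `FrobenioidTheta.lean`.

Theorem 5.6 (p.328 (PDF p.102)): "`Ψ` preserves the `(l, N)`-theta-saturated objects, as well as the natural isomorphism
`(l·Δ_Θ)_S ⊗ ℤ/Nℤ ⥲ μ_N(S)` … of Proposition 5.5 [i.e., `Ψ` transports this isomorphism for `S` to the
corresponding isomorphism for `Ψ(S)`]."  Printed proof: "by Proposition 5.1; [FrdI], Theorem 3.4, (iv), (v),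
it follows that `Ψ` preserves '`O^×(−)`' and induces a 1-compatible equivalence `Ψ^bs : D ⥲ D` … it follows
from Propositions 2.4, 2.6 that `Ψ` preserves '`(l·Δ_Θ)_{(−)}`'.  Thus, it follows immediately that `Ψ`
preserves the `(l, N)`-theta-saturated objects" — here `units_map_mapAut` (from a faithful 1-compatible
`Ψ^bs`), `preservesCyclotomes_of`, `preservesThetaSaturated_of` (with the transport `aΨ` of
`(l·Δ_Θ)_S ⊗ ℤ/Nℤ`, abc-iut-L2-t4's parameter); then the transport of the isomorphism is established at the
`l·N`-codomain `S₂` and "by the construction applied in the proof of Proposition 5.5, this preservation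
… in the specific case of `S₂` is sufficient to imply the preservation … for arbitrary `(l, N)`-theta-saturated
`S`" — here `preservesRigidityIso_of`: the REDUCTION to the instance at `S₂ = B_N` (hypothesis `hBN`, in
print obtained from the bi-Kummer data via Prop. 4.3 (iii) and "the Kummer class of the constant function
`u` does not affect the restriction … to `(l·Δ_Θ)`") via abc-iut-L2-t4's uniqueness theorem, given the
naturality of `aΨ` and of the unit pull-backs under `Ψ` (Props. 2.4, 2.6, Cor. 3.8 (iii); [FrdI] Thm. 3.4) and
"`Ψ` preserves linear morphisms" ([FrdI] Thm. 3.4 (iii)).  HONEST FRAMING: a kernel-checked implication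
between typed statements about the §5 data; typed ≠ discharged; no side taken on anything downstream. -/

namespace Literature.AnabelianGeometry.EtaleTheta

open CategoryTheory
open Literature.AlgebraicGeometry.Frobenioids

universe w v v' u u'

namespace ThetaFrobenioid

variable {C : Type u} [Category.{v} C] {D : Type u'} [Category.{v'} D] {𝔉 : ThetaFrobenioid.{w} C D}
variable (Ψ : C ≌ C)

/-! ### Cyclotomes and theta-saturation under `Ψ` -/

section Units

variable (Ψbs : D ⥤ D) (eΨ : Ψ.functor ⋙ 𝔉.base ≅ 𝔉.base ⋙ Ψbs)
include eΨ

/-- **`Ψ` preserves the cyclotomes `μ_N(S)`** (abc-iut-L2-t4's `PreservesCyclotomes`).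
[cite: MochizukiEtTh2009, Thm 5.6 p.328 (PDF p.102)] -/
theorem preservesCyclotomes_of : FrobenioidCyclotomicRigidity.PreservesCyclotomes 𝔉 Ψ :=
  fun _ _ hu => by
    rw [mem_muTorsion] at hu ⊢
    exact ⟨mapAut_mem_units Ψ Ψbs eΨ hu.1, by rw [← map_pow, hu.2, map_one]⟩

/-- **`Ψ` preserves the `(l, N)`-theta-saturated objects** (first clause of Thm. 5.6; abc-iut-L2-t4's
`PreservesThetaSaturated`), given the transport `aΨ` of `(l·Δ_Θ)_S ⊗ ℤ/Nℤ` ("`Ψ` preserves '`(l·Δ_Θ)_{(−)}`'",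
Props. 2.4, 2.6).  [cite: MochizukiEtTh2009, Thm 5.6 p.328–329 (PDF pp.102–103)] -/
theorem preservesThetaSaturated_of [Ψbs.Faithful]
    (aΨ : ∀ S : C, 𝔉.lDeltaModN S ≃* 𝔉.lDeltaModN (Ψ.functor.obj S)) :
    FrobenioidCyclotomicRigidity.PreservesThetaSaturated 𝔉 Ψ := by
  intro S
  constructor
  · rintro ⟨hμ, hc⟩
    exact ⟨(isMuSaturated_iff Ψ Ψbs eΨ S _).mp hμ, by rw [← hc]; exact (Nat.card_congr (aΨ S).toEquiv).symm⟩
  · rintro ⟨hμ, hc⟩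
    exact ⟨(isMuSaturated_iff Ψ Ψbs eΨ S _).mpr hμ, by rw [← hc]; exact Nat.card_congr (aΨ S).toEquiv⟩

end Units

/-! ### The transport of the rigidity isomorphism: reduction to the `l·N`-codomain `B_N` -/

section Transport

variable (Ψbs : D ⥤ D) [Ψbs.Faithful] (eΨ : Ψ.functor ⋙ 𝔉.base ≅ 𝔉.base ⋙ Ψbs)
include eΨ

/-- **The transport of the rigidity isomorphism** (second clause of Thm. 5.6; abc-iut-L2-t4's
`PreservesRigidityIso`), REDUCED to its instance `hBN` at the `l·N`-codomain `S₂ = B_N` ("this preservation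
of the natural isomorphism of Proposition 5.5 in the specific case of `S₂` is sufficient to imply the
preservation … for arbitrary `(l, N)`-theta-saturated `S`", p.329 (PDF p.103)) by abc-iut-L2-t4's PROVED uniqueness of
functorial rigidity families (`rigidityFamily_unique_of`, the "construction applied in the proof of
Proposition 5.5": `LinearlyReachableFromBN`), given: "`Ψ` preserves linear morphisms" (`hlin`, [FrdI]
Thm. 3.4 (iii)), the naturality of the transport `aΨ` of `(l·Δ_Θ)_{(−)} ⊗ ℤ/Nℤ` (`haΨ`, Props. 2.4, 2.6 /
Cor. 3.8 (iii): the subquotients are "preserved by arbitrary self-equivalences of `D`" functorially) and of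
the unit pull-backs (`hpull`, [FrdI] Thm. 3.4 (iv): "`Ψ` preserves '`O^×(−)`'" as a functor).
[cite: MochizukiEtTh2009, Thm 5.6 p.328–329 (PDF pp.102–103)] -/
theorem preservesRigidityIso_of
    (aΨ : ∀ S : C, 𝔉.lDeltaModN S ≃* 𝔉.lDeltaModN (Ψ.functor.obj S))
    (ρ : FrobenioidCyclotomicRigidity.RigidityFamily 𝔉) (hB : 𝔉.IsThetaSaturated 𝔉.BN)
    (hreach : FrobenioidCyclotomicRigidity.LinearlyReachableFromBN 𝔉)
    (hρ : FrobenioidCyclotomicRigidity.IsFunctorialLinear 𝔉 ρ)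
    (hlin : PreFrobenioidData.PreservesMor Ψ.functor 𝔉.IsLinear 𝔉.IsLinear)
    (haΨ : ∀ {S T : C} (φ : S ⟶ T) (x : 𝔉.lDeltaModN S),
      aΨ T (𝔉.lDeltaModNMap φ x) = 𝔉.lDeltaModNMap (Ψ.functor.map φ) (aΨ S x))
    (hpull : ∀ {S T : C} (φ : S ⟶ T) (u : 𝔉.muTorsion T 𝔉.N)
      (hu : Ψ.functor.mapAut T (u : Aut T) ∈ 𝔉.muTorsion (Ψ.functor.obj T) 𝔉.N),
      Ψ.functor.mapAut S (𝔉.muTorsionPull φ 𝔉.N u : Aut S) =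
        (𝔉.muTorsionPull (Ψ.functor.map φ) 𝔉.N ⟨_, hu⟩ : Aut (Ψ.functor.obj S)))
    (hBN : ∀ (hΨB : 𝔉.IsThetaSaturated (Ψ.functor.obj 𝔉.BN)) (x : 𝔉.lDeltaModN 𝔉.BN),
      (Ψ.functor.mapAut 𝔉.BN (ρ 𝔉.BN hB x : Aut 𝔉.BN) : Aut (Ψ.functor.obj 𝔉.BN)) =
        ρ (Ψ.functor.obj 𝔉.BN) hΨB (aΨ 𝔉.BN x)) :
    FrobenioidCyclotomicRigidity.PreservesRigidityIso 𝔉 Ψ ρ aΨ := by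
  have hsat := preservesThetaSaturated_of Ψ Ψbs eΨ aΨ
  have hcyc := preservesCyclotomes_of Ψ Ψbs eΨ (𝔉 := 𝔉)
  obtain ⟨μE, hμE⟩ := exists_muTorsionEquiv Ψ Ψbs eΨ (𝔉 := 𝔉) 𝔉.N
  refine ⟨hcyc, ?_⟩
  -- the transported family `ρ' S := Ψ⁻¹ ∘ ρ_{Ψ S} ∘ aΨ_S`
  let ρ' : FrobenioidCyclotomicRigidity.RigidityFamily 𝔉 := fun S hS =>
    ((aΨ S).trans (ρ (Ψ.functor.obj S) ((hsat S).mp hS))).trans (μE S).symm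
  have hρ'ap : ∀ (S : C) (hS : 𝔉.IsThetaSaturated S) (y : 𝔉.lDeltaModN S),
      μE S (ρ' S hS y) = ρ (Ψ.functor.obj S) ((hsat S).mp hS) (aΨ S y) :=
    fun S hS y => (μE S).apply_symm_apply _
  -- `ρ'` is functorial for linear morphisms
  have hρ' : FrobenioidCyclotomicRigidity.IsFunctorialLinear 𝔉 ρ' := by
    intro S T φ hφ hS hT x
    apply (μE S).injective
    apply Subtype.ext
    have hu : Ψ.functor.mapAut T (ρ' T hT (𝔉.lDeltaModNMap φ x) : Aut T) ∈
        𝔉.muTorsion (Ψ.functor.obj T) 𝔉.N := hcyc T _ (ρ' T hT (𝔉.lDeltaModNMap φ x)).2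
    have hw : (⟨_, hu⟩ : 𝔉.muTorsion (Ψ.functor.obj T) 𝔉.N) =
        ρ (Ψ.functor.obj T) ((hsat T).mp hT) (𝔉.lDeltaModNMap (Ψ.functor.map φ) (aΨ S x)) := by
      rw [← haΨ, ← hρ'ap T hT (𝔉.lDeltaModNMap φ x)]
      exact Subtype.ext (hμE T _).symm
    rw [hμE, hpull φ _ hu, hw, hρ (Ψ.functor.map φ) (hlin φ hφ) ((hsat S).mp hS) ((hsat T).mp hT),
      hρ'ap S hS x]
  -- `ρ'` agrees with `ρ` at `B_N`
  have hBN' : ρ' 𝔉.BN hB = ρ 𝔉.BN hB := by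
    apply MulEquiv.ext
    intro x
    apply (μE 𝔉.BN).injective
    apply Subtype.ext
    rw [hρ'ap 𝔉.BN hB x, hμE]
    exact (hBN _ x).symm
  have heq := FrobenioidCyclotomicRigidity.rigidityFamily_unique_of 𝔉 hreach hB hρ' hρ hBN'
  intro S hS hΨS x
  have hx : ρ S hS x = ρ' S hS x := by rw [heq]
  rw [hx, ← hμE S, hρ'ap S hS x]

/-- **[EtTh] Theorem 5.6 (Category-theoreticity of Frobenioid-theoretic Cyclotomic Rigidity), discharged
modulo its cited inputs**: abc-iut-L2-t4's `CyclotomicRigidityPreserved Ψ ρ aΨ` (both clauses) from a faithful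
1-compatible `Ψ^bs` (Thm. 4.4 (i) / [FrdI] Thm. 3.4 (v)), the transport `aΨ` with its naturality (Props. 2.4,
2.6), "`Ψ` preserves linear morphisms" and the unit pull-backs ([FrdI] Thm. 3.4 (iii), (iv)), the
functoriality and uniqueness inputs of Prop. 5.5 (`IsFunctorialLinear ρ`, `LinearlyReachableFromBN`), and
the instance of the transport at the `l·N`-codomain `B_N` (`hBN`).
[cite: MochizukiEtTh2009, Thm 5.6 p.328–329 (PDF pp.102–103)] -/
theorem cyclotomicRigidityPreserved_of
    (aΨ : ∀ S : C, 𝔉.lDeltaModN S ≃* 𝔉.lDeltaModN (Ψ.functor.obj S))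
    (ρ : FrobenioidCyclotomicRigidity.RigidityFamily 𝔉) (hB : 𝔉.IsThetaSaturated 𝔉.BN)
    (hreach : FrobenioidCyclotomicRigidity.LinearlyReachableFromBN 𝔉)
    (hρ : FrobenioidCyclotomicRigidity.IsFunctorialLinear 𝔉 ρ)
    (hlin : PreFrobenioidData.PreservesMor Ψ.functor 𝔉.IsLinear 𝔉.IsLinear)
    (haΨ : ∀ {S T : C} (φ : S ⟶ T) (x : 𝔉.lDeltaModN S),
      aΨ T (𝔉.lDeltaModNMap φ x) = 𝔉.lDeltaModNMap (Ψ.functor.map φ) (aΨ S x))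
    (hpull : ∀ {S T : C} (φ : S ⟶ T) (u : 𝔉.muTorsion T 𝔉.N)
      (hu : Ψ.functor.mapAut T (u : Aut T) ∈ 𝔉.muTorsion (Ψ.functor.obj T) 𝔉.N),
      Ψ.functor.mapAut S (𝔉.muTorsionPull φ 𝔉.N u : Aut S) =
        (𝔉.muTorsionPull (Ψ.functor.map φ) 𝔉.N ⟨_, hu⟩ : Aut (Ψ.functor.obj S)))
    (hBN : ∀ (hΨB : 𝔉.IsThetaSaturated (Ψ.functor.obj 𝔉.BN)) (x : 𝔉.lDeltaModN 𝔉.BN),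
      (Ψ.functor.mapAut 𝔉.BN (ρ 𝔉.BN hB x : Aut 𝔉.BN) : Aut (Ψ.functor.obj 𝔉.BN)) =
        ρ (Ψ.functor.obj 𝔉.BN) hΨB (aΨ 𝔉.BN x)) :
    FrobenioidCyclotomicRigidity.CyclotomicRigidityPreserved 𝔉 Ψ ρ aΨ :=
  ⟨preservesThetaSaturated_of Ψ Ψbs eΨ aΨ,
    preservesRigidityIso_of Ψ Ψbs eΨ aΨ ρ hB hreach hρ hlin haΨ hpull hBN⟩

end Transport

end ThetaFrobenioid

end Literature.AnabelianGeometry.EtaleTheta
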